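import Summits.Ventures.PercRepro.Night2RigidPairLoss

/-!
# PercRepro — the rigid cell: residual capacity of the targets (night-2, gen 18)

In the rigid cell (`|E ∖ G| = q − 1`, `kColoops = q − 2`, `M` simple) a shadow set `S = K ∪ P` with `|P| ≥ 4`
has at most ONE thin covering preimage (`card_thin_coverPreimages_le_one`: two of them would put `P` inside the
rank-`2` closure of `P ∖ {w₁, w₂}`, against `ρ(P) = 3`), so `L1 S ≤ Φ/(q+1)` (`L1_le_of_four_le`) and
`cap2 S ≥ c − Φ/(q+1) = c′` (**`cap2_ge_cprime`**); when moreover `|G ∖ S| ≤ 1` no layer-0 preimage exists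
(`k1_eq_zero_of_card_sdiff_le_one`: the complement of such a preimage has rank `≤ q + 1`), so `capS S = 1` and
`cap2 S ≥ 1 − Φ/(q+1) = c″` (**`cap2_ge_cdouble`**).  Paper §7, «residual capacity of the targets».
-/

namespace PercRepro.Shadow

open Finset PerFlat ThmH

variable {α : Type*} [DecidableEq α] {M : Matroid α} [M.Finite]

/-- The minimal capacity `c = (q+4)/(q(q+1))` of the rigid cell. -/
noncomputable def cRig (q : ℕ) : ℚ := ((q : ℚ) + 4) / ((q : ℚ) * ((q : ℚ) + 1))

/-- `c′ = c − Φ/(q+1)`. -/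
noncomputable def cPrime (q : ℕ) : ℚ := cRig q - phiQ q / ((q : ℚ) + 1)

/-- `c″ = 1 − Φ/(q+1)`. -/
noncomputable def cDouble (q : ℕ) : ℚ := 1 - phiQ q / ((q : ℚ) + 1)

open scoped Classical in
/-- Rigid cell: `capS S ≥ c` for every `S ⊆ G`. -/
theorem capS_ge_cR {q : ℕ} {G : Finset α} (hd : (gr M \ G).card = q - 1) (hk : kColoops M G + 2 = q)
    {S : Finset α} (hS : S ⊆ G) : cRig q ≤ capS M q G S := by
  have hq2 : 2 ≤ q := by omega
  have h1 : 1 - (kColoops M G : ℚ) * phiQ q / (1 + ((q : ℚ) - 1)) ≤ capS M q G S := by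
    unfold capS
    have hk1 : (k1 M q G S : ℚ) ≤ (kColoops M G : ℚ) := by exact_mod_cast k1_le_kColoops hS
    have hd1 : ((gr M \ G).card : ℚ) = (q : ℚ) - 1 := by
      rw [hd]; have : 1 ≤ q := by omega
      push_cast [Nat.cast_sub this]; ring
    rw [hd1]
    have hpos : (0 : ℚ) < 1 + ((q : ℚ) - 1) := by
      have : (1 : ℚ) ≤ (q : ℚ) := by exact_mod_cast (by omega : 1 ≤ q)
      linarith
    apply sub_le_sub_left
    apply div_le_div_of_nonneg_right _ hpos.le
    exact mul_le_mul_of_nonneg_right hk1 (phiQ_pos q).le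
  refine le_trans (le_of_eq ?_) h1
  have hkq : (kColoops M G : ℚ) = (q : ℚ) - 2 := by
    have : kColoops M G = q - 2 := by omega
    rw [this]; push_cast [Nat.cast_sub hq2]; ring
  rw [hkq]
  unfold cRig phiQ
  have hq0 : (q : ℚ) ≠ 0 := by exact_mod_cast (by omega : q ≠ 0)
  have hq1 : (q : ℚ) + 1 ≠ 0 := by positivity
  rw [show (1 : ℚ) + ((q : ℚ) - 1) = (q : ℚ) by ring]
  field_simp
  ring

set_option maxHeartbeats 1000000 in
open scoped Classical in
/-- Rigid cell: a shadow set `S` with `|S ∖ K| ≥ 4` has at most one thin covering preimage. -/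
theorem card_thin_coverPreimages_le_one {q : ℕ} {G : Finset α} (hG : G ∈ flatsQ M (q + 1))
    (hd : (gr M \ G).card ≤ q) (hk : kColoops M G + 2 = q)
    (hs : ∀ e ∈ gr M, ∀ f ∈ gr M, e ≠ f → rkN M {e, f} = 2) {S : Finset α}
    (hS : S ∈ shadowAt M (q + 2) q (Uq M (q + 2) q) G) (h4 : 4 ≤ (S \ coloops M G).card) :
    ((coverPreimages M (Uq M (q + 2) q) G S).filter (fun B => B ∉ lay0 M q G)).card ≤ 1 := by
  have hGg : G ⊆ gr M := (mem_flatsQ.1 hG).1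
  have hSG : S ⊆ G := subset_G_of_mem_shadowAt hS
  have hKS : coloops M G ⊆ S := coloops_subset_of_mem_shadowAt hS
  have hSr : M.eRk (S : Set α) = ((q + 1 : ℕ) : ℕ∞) :=
    eRk_eq_of_mem_Yq_diag (mem_shadow.1 (mem_shadowAt.1 hS).1).1
  -- ρ(S ∖ K) = 3
  have hPr : M.eRk ((S \ coloops M G : Finset α) : Set α) = 3 := by
    have h := eRk_eq_kColoops_add_sdiff hGg hSG hKS
    rw [hSr] at h
    have hfin : M.eRk ((S \ coloops M G : Finset α) : Set α) ≠ ⊤ := by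
      intro ht; rw [ht] at h; exact absurd h (by simp)
    obtain ⟨n, hn⟩ := ENat.ne_top_iff_exists.1 hfin
    rw [← hn] at h ⊢
    have : q + 1 = kColoops M G + n := by exact_mod_cast h
    have : n = 3 := by omega
    rw [this]; rfl
  -- two distinct thin preimages lead to a contradiction
  rw [Finset.card_le_one]
  intro B₁ hB₁ B₂ hB₂
  by_contra hne
  -- each thin preimage is S ∖ w with w ∈ S ∖ K
  have key : ∀ B ∈ (coverPreimages M (Uq M (q + 2) q) G S).filter (fun B => B ∉ lay0 M q G),
      ∃ w ∈ S \ coloops M G, B = S.erase w := by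
    intro B hB
    rw [Finset.mem_filter, mem_coverPreimages] at hB
    obtain ⟨⟨hBm, hcov⟩, hB0⟩ := hB
    obtain ⟨w, hw, hwS⟩ := mem_coverSets.1 hcov
    have hBU : B ∈ Uq M (q + 2) q := (mem_membersIn.1 hBm).1
    have hwB : w ∉ B := notMem_of_notMem_clF hBU (Finset.mem_sdiff.1 hw).2
    have hBt : B ∈ thinMembers M q G := mem_thinMembers.2 ⟨hBm, hB0⟩
    refine ⟨w, Finset.mem_sdiff.2 ⟨by rw [← hwS]; exact Finset.mem_insert_self _ _,
      fun h => hwB (coloops_subset_of_mem_thinMembers hG hd hBt h)⟩, ?_⟩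
    rw [← hwS, Finset.erase_insert hwB]
  obtain ⟨w₁, hw₁, rfl⟩ := key B₁ hB₁
  obtain ⟨w₂, hw₂, rfl⟩ := key B₂ hB₂
  have hw12 : w₁ ≠ w₂ := fun h => hne (by rw [h])
  have ht₁ : S.erase w₁ ∈ thinMembers M q G := by
    rw [Finset.mem_filter, mem_coverPreimages] at hB₁; exact mem_thinMembers.2 ⟨hB₁.1.1, hB₁.2⟩
  have ht₂ : S.erase w₂ ∈ thinMembers M q G := by
    rw [Finset.mem_filter, mem_coverPreimages] at hB₂; exact mem_thinMembers.2 ⟨hB₂.1.1, hB₂.2⟩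
  -- ρ((S ∖ w_i) ∖ K) = 2
  have hr₁ := eRk_sdiff_coloops_eq_two hG hd hk ht₁
  have hr₂ := eRk_sdiff_coloops_eq_two hG hd hk ht₂
  obtain ⟨P, hP⟩ : ∃ P, P = S \ coloops M G := ⟨_, rfl⟩
  rw [← hP] at hPr h4 hw₁ hw₂
  have hP₁ : (S.erase w₁) \ coloops M G = P.erase w₁ := by
    rw [hP]; ext x; simp only [Finset.mem_sdiff, Finset.mem_erase]; tauto
  have hP₂ : (S.erase w₂) \ coloops M G = P.erase w₂ := by
    rw [hP]; ext x; simp only [Finset.mem_sdiff, Finset.mem_erase]; tauto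
  rw [hP₁] at hr₁
  rw [hP₂] at hr₂
  -- Q = P ∖ {w₁, w₂} has ≥ 2 elements, hence rank 2, and its closure contains P
  obtain ⟨Q, hQ⟩ : ∃ Q, Q = (P.erase w₁).erase w₂ := ⟨_, rfl⟩
  have hw₂P : w₂ ∈ P.erase w₁ := Finset.mem_erase.2 ⟨Ne.symm hw12, hw₂⟩
  have hQcard : 2 ≤ Q.card := by
    rw [hQ, Finset.card_erase_of_mem hw₂P, Finset.card_erase_of_mem hw₁]; omega
  obtain ⟨a, ha, b, hb, hab⟩ := Finset.one_lt_card.1 (by omega : 1 < Q.card)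
  have hQP : Q ⊆ P := by rw [hQ]; exact (Finset.erase_subset _ _).trans (Finset.erase_subset _ _)
  have hPG : P ⊆ G := by rw [hP]; exact Finset.sdiff_subset.trans hSG
  have hQr : M.eRk (Q : Set α) = 2 := by
    apply le_antisymm
    · rw [← hr₁]; exact M.eRk_mono (by rw [hQ]; exact_mod_cast (Finset.erase_subset _ _ : (P.erase w₁).erase w₂ ⊆ P.erase w₁))
    · rw [← eRk_pair_two_simple_rigid hs (hGg (hPG (hQP ha))) (hGg (hPG (hQP hb))) hab]
      apply M.eRk_mono
      intro x hx
      rw [Finset.mem_coe, Finset.mem_insert, Finset.mem_singleton] at hx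
      rcases hx with rfl | rfl
      · exact_mod_cast ha
      · exact_mod_cast hb
  -- closures: cl Q = cl (P ∖ w₁) = cl (P ∖ w₂) (rank-2 flats, Q inside both)
  have hflat₁ : clF M (P.erase w₁) ∈ flatsQ M (1 + 1) := by
    rw [mem_flatsQ, ← Finset.coe_subset, coe_clF, coe_gr]
    refine ⟨M.closure_subset_ground _, M.isFlat_closure _, ?_⟩
    rw [M.eRk_closure_eq, hr₁]; rfl
  have hflat₂ : clF M (P.erase w₂) ∈ flatsQ M (1 + 1) := by
    rw [mem_flatsQ, ← Finset.coe_subset, coe_clF, coe_gr]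
    refine ⟨M.closure_subset_ground _, M.isFlat_closure _, ?_⟩
    rw [M.eRk_closure_eq, hr₂]; rfl
  have hQ₁ : Q ⊆ P.erase w₁ := by rw [hQ]; exact Finset.erase_subset _ _
  have hQ₂ : Q ⊆ P.erase w₂ := by
    rw [hQ]
    intro x hx
    rw [Finset.mem_erase, Finset.mem_erase] at hx
    rw [Finset.mem_erase]
    exact ⟨hx.1, hx.2.2⟩
  have hQr' : M.eRk ((clF M Q : Finset α) : Set α) = ((1 + 1 : ℕ) : ℕ∞) := by
    rw [coe_clF, M.eRk_closure_eq, hQr]; rfl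
  have hcl₁ : clF M Q = clF M (P.erase w₁) :=
    flat_eq_of_subset_of_eRk_eq hflat₁ (by rw [coe_clF]; exact M.isFlat_closure _) (clF_mono hQ₁) hQr'
  have hcl₂ : clF M Q = clF M (P.erase w₂) :=
    flat_eq_of_subset_of_eRk_eq hflat₂ (by rw [coe_clF]; exact M.isFlat_closure _) (clF_mono hQ₂) hQr'
  -- P ⊆ cl Q, so ρ(P) ≤ 2
  have hPcl : P ⊆ clF M Q := by
    intro x hx
    by_cases hx₁ : x = w₁
    · subst hx₁
      rw [hcl₂]
      exact subset_clF_of_subset_gr ((Finset.erase_subset _ _).trans (hPG.trans hGg))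
        (Finset.mem_erase.2 ⟨hw12, hx⟩)
    · rw [hcl₁]
      exact subset_clF_of_subset_gr ((Finset.erase_subset _ _).trans (hPG.trans hGg))
        (Finset.mem_erase.2 ⟨hx₁, hx⟩)
  have hle : M.eRk (P : Set α) ≤ M.eRk (Q : Set α) := by
    rw [← M.eRk_closure_eq (Q : Set α), ← coe_clF]
    exact M.eRk_mono (by exact_mod_cast hPcl)
  rw [hPr, hQr] at hle
  have h32 : (3 : ℕ) ≤ 2 := by exact_mod_cast hle
  omega

open scoped Classical in
/-- Rigid cell: `L1 S ≤ Φ/(q+1)` at a shadow set with `|S ∖ K| ≥ 4`. -/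
theorem L1_le_of_four_le {q : ℕ} {G : Finset α} (hG : G ∈ flatsQ M (q + 1))
    (hd : (gr M \ G).card = q - 1) (hk : kColoops M G + 2 = q)
    (hs : ∀ e ∈ gr M, ∀ f ∈ gr M, e ≠ f → rkN M {e, f} = 2) {S : Finset α}
    (hS : S ∈ shadowAt M (q + 2) q (Uq M (q + 2) q) G) (h4 : 4 ≤ (S \ coloops M G).card) :
    L1 M q G S ≤ phiQ q / ((q : ℚ) + 1) := by
  have hd' : (gr M \ G).card ≤ q := by omega
  unfold L1
  have hterm : ∀ B ∈ (coverPreimages M (Uq M (q + 2) q) G S).filter (fun B => B ∉ lay0 M q G),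
      req M q B ≤ phiQ q / ((q : ℚ) + 1) := by
    intro B hB
    rw [Finset.mem_filter, mem_coverPreimages] at hB
    exact req_le_of_thin hG hd (mem_thinMembers.2 ⟨hB.1.1, hB.2⟩)
  calc ∑ B ∈ (coverPreimages M (Uq M (q + 2) q) G S).filter (fun B => B ∉ lay0 M q G), req M q B
      ≤ ∑ _B ∈ (coverPreimages M (Uq M (q + 2) q) G S).filter (fun B => B ∉ lay0 M q G),
          phiQ q / ((q : ℚ) + 1) := Finset.sum_le_sum hterm
    _ = (((coverPreimages M (Uq M (q + 2) q) G S).filter (fun B => B ∉ lay0 M q G)).card : ℚ) *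
          (phiQ q / ((q : ℚ) + 1)) := by rw [Finset.sum_const, nsmul_eq_mul]
    _ ≤ 1 * (phiQ q / ((q : ℚ) + 1)) := by
        apply mul_le_mul_of_nonneg_right _ (div_nonneg (phiQ_pos q).le (by positivity))
        exact_mod_cast card_thin_coverPreimages_le_one hG hd' hk hs hS h4
    _ = phiQ q / ((q : ℚ) + 1) := one_mul _

open scoped Classical in
/-- `cap2 S ≥ capS S − L1 S`. -/
theorem cap2_ge_capS_sub_L1_of_le {q : ℕ} {G : Finset α} (hG : G ∈ flatsQ M (q + 1))
    (hd : (gr M \ G).card ≤ q) (S : Finset α) : capS M q G S - L1 M q G S ≤ cap2 M q G S := by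
  unfold cap2
  have h1 : fS M q G S ≤ 1 := fS_le_one (capS_nonneg' hG hd S)
  have h2 : 0 ≤ L1 M q G S := L1_nonneg q G S
  nlinarith [mul_le_mul_of_nonneg_right h1 h2]

open scoped Classical in
/-- **Rigid cell: `cap2 S ≥ c′` at every shadow set with `|S ∖ K| ≥ 4`.** -/
theorem cap2_ge_cPrime {q : ℕ} {G : Finset α} (hG : G ∈ flatsQ M (q + 1))
    (hd : (gr M \ G).card = q - 1) (hk : kColoops M G + 2 = q)
    (hs : ∀ e ∈ gr M, ∀ f ∈ gr M, e ≠ f → rkN M {e, f} = 2) {S : Finset α}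
    (hS : S ∈ shadowAt M (q + 2) q (Uq M (q + 2) q) G) (h4 : 4 ≤ (S \ coloops M G).card) :
    cPrime q ≤ cap2 M q G S := by
  have hd' : (gr M \ G).card ≤ q := by omega
  unfold cPrime
  have h1 := cap2_ge_capS_sub_L1_of_le hG hd' S
  have h2 := capS_ge_cR hd hk (subset_G_of_mem_shadowAt hS)
  have h3 := L1_le_of_four_le hG hd hk hs hS h4
  linarith

open scoped Classical in
/-- Rigid cell: a shadow set with `|G ∖ S| ≤ 1` has no layer-0 covering preimage. -/
theorem k1_eq_zero_of_card_sdiff_le_one {q : ℕ} {G : Finset α} (hG : G ∈ flatsQ M (q + 1))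
    (hd : (gr M \ G).card = q - 1) {S : Finset α}
    (hS : S ∈ shadowAt M (q + 2) q (Uq M (q + 2) q) G) (h1 : (G \ S).card ≤ 1) : k1 M q G S = 0 := by
  have hSG : S ⊆ G := subset_G_of_mem_shadowAt hS
  have hGg : G ⊆ gr M := (mem_flatsQ.1 hG).1
  unfold k1
  rw [Finset.card_eq_zero, Finset.filter_eq_empty_iff]
  intro B hB hB0
  rw [mem_coverPreimages] at hB
  obtain ⟨hBm, hcov⟩ := hB
  obtain ⟨y, hy, hyS⟩ := mem_coverSets.1 hcov
  have hBU : B ∈ Uq M (q + 2) q := (mem_membersIn.1 hBm).1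
  have hyB : y ∉ B := notMem_of_notMem_clF hBU (Finset.mem_sdiff.1 hy).2
  -- gr ∖ B ⊆ (gr ∖ G) ∪ (G ∖ S) ∪ {y}: rank ≤ card ≤ (q − 1) + 1 + 1 = q + 1 < q + 2
  have hsub : gr M \ B ⊆ (gr M \ G) ∪ (G \ S) ∪ {y} := by
    intro x hx
    rw [Finset.mem_sdiff] at hx
    rw [Finset.mem_union, Finset.mem_union, Finset.mem_sdiff, Finset.mem_sdiff, Finset.mem_singleton]
    by_cases hxG : x ∈ G
    · by_cases hxS : x ∈ S
      · right
        have : x ∈ insert y B := by rw [hyS]; exact hxS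
        rw [Finset.mem_insert] at this
        exact this.resolve_right hx.2
      · exact Or.inl (Or.inr ⟨hxG, hxS⟩)
    · exact Or.inl (Or.inl ⟨hx.1, hxG⟩)
  have hcard : ((gr M \ B).card : ℕ) ≤ q + 1 := by
    calc (gr M \ B).card ≤ ((gr M \ G) ∪ (G \ S) ∪ {y}).card := Finset.card_le_card hsub
      _ ≤ ((gr M \ G) ∪ (G \ S)).card + ({y} : Finset α).card := Finset.card_union_le _ _
      _ ≤ (gr M \ G).card + (G \ S).card + 1 := by
          rw [Finset.card_singleton]; exact Nat.add_le_add_right (Finset.card_union_le _ _) 1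
      _ ≤ q + 1 := by
          have hq1 := one_le_card_compl_of_member hG hBU
          rw [hd] at hq1 ⊢
          omega
  have hr : M.eRk ((gr M \ B : Finset α) : Set α) = ((q + 2 : ℕ) : ℕ∞) := (mem_Uq.1 hBU).2.2
  have hle : M.eRk ((gr M \ B : Finset α) : Set α) ≤ ((gr M \ B).card : ℕ∞) := by
    calc M.eRk ((gr M \ B : Finset α) : Set α) ≤ ((gr M \ B : Finset α) : Set α).encard := M.eRk_le_encard _
      _ = ((gr M \ B).card : ℕ∞) := by rw [Set.encard_coe_eq_coe_finsetCard]
  rw [hr] at hle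
  have : q + 2 ≤ (gr M \ B).card := by exact_mod_cast hle
  omega

open scoped Classical in
/-- **Rigid cell: `cap2 S ≥ c″` at every shadow set with `|S ∖ K| ≥ 4` and `|G ∖ S| ≤ 1`.** -/
theorem cap2_ge_cDouble {q : ℕ} {G : Finset α} (hG : G ∈ flatsQ M (q + 1))
    (hd : (gr M \ G).card = q - 1) (hk : kColoops M G + 2 = q)
    (hs : ∀ e ∈ gr M, ∀ f ∈ gr M, e ≠ f → rkN M {e, f} = 2) {S : Finset α}
    (hS : S ∈ shadowAt M (q + 2) q (Uq M (q + 2) q) G) (h4 : 4 ≤ (S \ coloops M G).card)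
    (h1 : (G \ S).card ≤ 1) : cDouble q ≤ cap2 M q G S := by
  have hd' : (gr M \ G).card ≤ q := by omega
  unfold cDouble
  have hc := cap2_ge_capS_sub_L1_of_le hG hd' S
  have hL := L1_le_of_four_le hG hd hk hs hS h4
  have hcap : capS M q G S = 1 := by
    unfold capS
    rw [k1_eq_zero_of_card_sdiff_le_one hG hd hS h1]
    simp
  linarith

end PercRepro.Shadow
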